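import Summits.NavierStokesRegularity.NavierStokesRegularity.Theorems.FrozenSignCascadeBoundedEnvelopeContinuationMorreyOfEnvelope
import Literature.Analysis.FunctionSpaces.PlancherelL1L2
import Literature.Analysis.FluidPDE.SelfSimilar
import HarnessLib

/-!
# Route FrozenSignCascade · crux `BoundedEnvelopeContinuation` — the dual `PM²` bound implies the
# Morrey bound (`PM² ⊂ Ṁ^{2,1}` in dual form)

Helper file for the crux item stmt-NavierStokesRegularity-10579 (`BoundedEnvelopeContinuation`,
conjunct (B) of route `FrozenSignCascade`), line `registered`; lands `--supports` that item
(registered sub-goal `stub_morreyOfPMDual`; lead c5, reshape r5: hypothesis four of the open stub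
`stub_liouvillePM` (L_PM) — the all-radii Morrey bound — follows from hypothesis five — the dual
pseudo-measure bound —, so the honest residue of the line is Liouville on `L^∞_t PM²_x` alone).

**Theorem (`setIntegral_ball_norm_sq_le_of_pmDual`).** If `w : ℝ³ → ℝ³` is a.e.-strongly
measurable and bounded and each component obeys `|∫ w_l φ| ≤ C ∫ ‖𝓕φ(ξ)‖/‖ξ‖² dξ` for all real
`φ` with `φ` and `‖𝓕φ‖/‖ξ‖²` integrable, then `∫_{B_r(y)} ‖w‖² ≤ (54|B₁|³ + 18|B₁|) C² r` for all
`y`, `r > 0` (the constant of lead c1's Fourier-side `stub_morreyOfEnvelope`).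
**Proof.** Test with `φ = 1_{B_r(y)} w_l ∈ L¹ ∩ L² ∩ L^∞`, so `∫ w_l φ = E := ∫_{B_r(y)} w_l²`, and
split `J = ∫ ‖𝓕φ‖/‖ξ‖²` at `‖ξ‖ = 1/r`: low frequencies by `‖𝓕φ‖_∞ ≤ ‖φ‖₁ ≤ (|B₁|r³)^{1/2}E^{1/2}`
and `∫_{‖ξ‖≤ρ} ‖ξ‖⁻² ≤ 3|B₁|ρ` (`MorreySharp.integral_ball_inv_norm_sq_le`); high frequencies by
Cauchy–Schwarz, Plancherel on `L¹ ∩ L²` (`integral_norm_sq_fourierIntegral_eq`) and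
`∫_{‖ξ‖>ρ} ‖ξ‖⁻⁴ ≤ 3|B₁|ρ⁻¹` (`MorreySharp.integral_tail_inv_norm_four_le`). Hence
`E ≤ C K (rE)^{1/2}`, `K = 3|B₁|^{3/2} + (3|B₁|)^{1/2}`, i.e. `E ≤ C²K² r ≤ (18|B₁|³ + 6|B₁|) C² r`;
sum over the three components.
References: P. G. Lemarié-Rieusset, *The Navier–Stokes problem in the 21st century* (2016), §8.5;
M. Cannone, G. Karch, J. Differential Equations 197 (2004), §2; folklore.
-/

noncomputable section

set_option linter.dupNamespace false -- nested layout Summit.<S>.<Sub>, Sub = S (D-0017)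

open MeasureTheory Set Metric Real Filter Topology
open scoped FourierTransform RealInnerProductSpace ENNReal
open Literature.Analysis.FunctionSpaces

namespace Summit.NavierStokesRegularity.NavierStokesRegularity.Theorems.BoundedEnvelope

namespace PMDual

/-! ### Elementary tools -/

/-- **Cauchy–Schwarz**, square-root form: `∫ f g ≤ √(∫ f²) √(∫ g²)` (`p = q = 2`). [folklore] -/
theorem integral_mul_le_sqrt_mul_sqrt {μ : Measure (EuclideanSpace ℝ (Fin 3))} {f g : (EuclideanSpace ℝ (Fin 3)) → ℝ}
    (hf0 : 0 ≤ᵐ[μ] f) (hg0 : 0 ≤ᵐ[μ] g) (hf : MemLp f 2 μ) (hg : MemLp g 2 μ) :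
    ∫ a, f a * g a ∂μ ≤ Real.sqrt (∫ a, f a ^ 2 ∂μ) * Real.sqrt (∫ a, g a ^ 2 ∂μ) := by
  have hf' : MemLp f (ENNReal.ofReal 2) μ := by simpa using hf
  have hg' : MemLp g (ENNReal.ofReal 2) μ := by simpa using hg
  have h := integral_mul_le_Lp_mul_Lq_of_nonneg Real.HolderConjugate.two_two hf0 hg0 hf' hg'
  simp only [Real.rpow_two] at h
  rwa [Real.sqrt_eq_rpow, Real.sqrt_eq_rpow]

/-! ### The one-component estimate -/
set_option maxHeartbeats 400000 in -- buildfix (bf3-g26): 160k/180k FAIL, 200k PASS at accept time; line-neutral budget line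
/-- **One component**: a bounded a.e.-strongly measurable `w_l` with the dual `PM²` bound of
constant `C ≥ 0` has `∫_{B_r(y)} w_l² ≤ (18|B₁|³ + 6|B₁|) C² r` (module docstring). [folklore] -/
theorem setIntegral_sq_le_of_pmDual {wl : (EuclideanSpace ℝ (Fin 3)) → ℝ} {C B : ℝ} (hC : 0 ≤ C)
    (hwm : AEStronglyMeasurable wl volume) (hwb : ∀ x, |wl x| ≤ B)
    (hPM : ∀ φ : (EuclideanSpace ℝ (Fin 3)) → ℝ, Integrable φ →
      Integrable (fun ξ : (EuclideanSpace ℝ (Fin 3)) => ‖𝓕 (fun x => (φ x : ℂ)) ξ‖ / ‖ξ‖ ^ 2) →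
      |∫ x, wl x * φ x| ≤ C * ∫ ξ, ‖𝓕 (fun x => (φ x : ℂ)) ξ‖ / ‖ξ‖ ^ 2)
    (y : (EuclideanSpace ℝ (Fin 3))) {r : ℝ} (hr : 0 < r) :
    ∫ x in ball y r, wl x ^ 2 ≤
      (18 * (volume (ball (0 : EuclideanSpace ℝ (Fin 3)) 1)).toReal ^ 3 + 6 * (volume (ball (0 : EuclideanSpace ℝ (Fin 3)) 1)).toReal) *
        C ^ 2 * r := by
  -- ### notation
  obtain ⟨V, hV⟩ : ∃ V : ℝ, V = (volume (ball (0 : EuclideanSpace ℝ (Fin 3)) 1)).toReal := ⟨_, rfl⟩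
  rw [← hV]
  have hV0 : 0 ≤ V := by rw [hV]; exact ENNReal.toReal_nonneg
  obtain ⟨S, hS⟩ : ∃ S : Set (EuclideanSpace ℝ (Fin 3)), S = ball y r := ⟨_, rfl⟩
  rw [← hS]
  have hSm : MeasurableSet S := by rw [hS]; exact measurableSet_ball
  have hSlt : volume S < ∞ := by rw [hS]; exact measure_ball_lt_top
  have hSfin : volume S ≠ ∞ := hSlt.ne
  haveI : IsFiniteMeasure (volume.restrict S) := ⟨by
    rw [Measure.restrict_apply_univ]; exact hSlt⟩
  have hvolS : (volume S).toReal = r ^ 3 * V := by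
    rw [hS, hV, Measure.addHaar_ball volume y hr.le, finrank_euclideanSpace_fin,
      ENNReal.toReal_mul, ENNReal.toReal_ofReal (pow_nonneg hr.le 3)]
  -- ### the test function `φ = 1_S w_l`
  obtain ⟨φ, hφ⟩ : ∃ φ : (EuclideanSpace ℝ (Fin 3)) → ℝ, φ = S.indicator wl := ⟨_, rfl⟩
  have hwb' : ∀ x, ‖wl x‖ ≤ B := fun x => by rw [Real.norm_eq_abs]; exact hwb x
  have hφ_int : Integrable φ := by
    rw [hφ]
    exact (integrable_indicator_iff hSm).2
      (Measure.integrableOn_of_bounded hSfin hwm (Eventually.of_forall hwb'))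
  have hφ_L2 : MemLp φ 2 volume := by
    rw [hφ]
    exact (memLp_indicator_iff_restrict hSm).2
      (MemLp.of_bound hwm.restrict B (Eventually.of_forall hwb'))
  have hφ_bd : ∀ x, |φ x| ≤ |wl x| := fun x => by
    rw [hφ]
    by_cases hx : x ∈ S
    · rw [indicator_of_mem hx]
    · rw [indicator_of_notMem hx, abs_zero]; exact abs_nonneg _
  -- the energy `E = ∫_S w_l²` and its square root `e`
  obtain ⟨E, hE⟩ : ∃ E : ℝ, E = ∫ x in S, wl x ^ 2 := ⟨_, rfl⟩
  rw [← hE]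
  have hE0 : 0 ≤ E := by rw [hE]; exact setIntegral_nonneg hSm fun x _ => sq_nonneg _
  obtain ⟨e, he⟩ : ∃ e : ℝ, e = Real.sqrt E := ⟨_, rfl⟩
  have he0 : 0 ≤ e := by rw [he]; exact Real.sqrt_nonneg _
  have heE : e ^ 2 = E := by rw [he]; exact Real.sq_sqrt hE0
  obtain ⟨s, hs⟩ : ∃ s : ℝ, s = Real.sqrt r := ⟨_, rfl⟩
  have hs0 : 0 < s := by rw [hs]; exact Real.sqrt_pos.2 hr
  have hsr : s ^ 2 = r := by rw [hs]; exact Real.sq_sqrt hr.le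
  -- `∫ w_l φ = E` and `∫ φ² = E`
  have hpair : ∫ x, wl x * φ x = E := by
    have : (fun x => wl x * φ x) = S.indicator (fun x => wl x ^ 2) := by
      funext x
      rw [hφ]
      by_cases hx : x ∈ S
      · rw [indicator_of_mem hx, indicator_of_mem hx, sq]
      · rw [indicator_of_notMem hx, indicator_of_notMem hx, mul_zero]
    rw [this, integral_indicator hSm, hE]
  have hφsq : ∫ x, φ x ^ 2 = E := by
    have : (fun x => φ x ^ 2) = S.indicator (fun x => wl x ^ 2) := by
      funext x
      rw [hφ]
      by_cases hx : x ∈ S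
      · rw [indicator_of_mem hx, indicator_of_mem hx]
      · rw [indicator_of_notMem hx, indicator_of_notMem hx]; ring
    rw [this, integral_indicator hSm, hE]
  -- `‖φ‖₁ ≤ √(|S|) √E = √V · r · s · e` (Cauchy–Schwarz on the ball)
  obtain ⟨A₁, hA₁⟩ : ∃ A₁ : ℝ, A₁ = ∫ x, |φ x| := ⟨_, rfl⟩
  have hA₁_eq : A₁ = ∫ x in S, |wl x| := by
    have : (fun x => |φ x|) = S.indicator (fun x => |wl x|) := by
      funext x
      rw [hφ]
      by_cases hx : x ∈ S
      · rw [indicator_of_mem hx, indicator_of_mem hx]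
      · rw [indicator_of_notMem hx, indicator_of_notMem hx, abs_zero]
    rw [hA₁, this, integral_indicator hSm]
  have hA₁_le : A₁ ≤ Real.sqrt V * r * s * e := by
    have hCS := integral_mul_le_sqrt_mul_sqrt (μ := volume.restrict S) (f := fun _ => (1 : ℝ))
      (g := fun x => |wl x|) (Eventually.of_forall fun _ => zero_le_one)
      (Eventually.of_forall fun _ => abs_nonneg _) (memLp_const 1)
      (MemLp.of_bound hwm.restrict.norm B (Eventually.of_forall fun x => by
        rw [Real.norm_eq_abs, abs_abs]; exact hwb x))
    simp only [one_mul, one_pow, sq_abs] at hCS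
    rw [integral_const, smul_eq_mul, mul_one, measureReal_restrict_apply_univ, measureReal_def,
      hvolS] at hCS
    rw [hA₁_eq]
    refine hCS.trans (le_of_eq ?_)
    rw [← hE, ← he, Real.sqrt_mul (pow_nonneg hr.le 3), show r ^ 3 = (r * s) ^ 2 by
      rw [mul_pow, hsr]; ring, Real.sqrt_sq (mul_nonneg hr.le hs0.le)]
    ring
  -- ### the Fourier transform of `φ`: continuous, bounded by `A₁`, Plancherel
  obtain ⟨φc, hφc⟩ : ∃ φc : (EuclideanSpace ℝ (Fin 3)) → ℂ, φc = fun x => (φ x : ℂ) := ⟨_, rfl⟩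
  have hφc_int : Integrable φc := by rw [hφc]; exact hφ_int.ofReal
  have hφc_L2 : MemLp φc 2 volume := by
    refine (memLp_two_iff_integrable_sq_norm hφc_int.aestronglyMeasurable).2 ?_
    have h2 := (memLp_two_iff_integrable_sq hφ_int.aestronglyMeasurable).1 hφ_L2
    refine h2.congr (Eventually.of_forall fun x => ?_)
    simp [hφc, Complex.norm_real, sq_abs]
  obtain ⟨F, hF⟩ : ∃ F : (EuclideanSpace ℝ (Fin 3)) → ℂ, F = 𝓕 φc := ⟨_, rfl⟩
  have hF_cont : Continuous F := by
    rw [hF]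
    exact VectorFourier.fourierIntegral_continuous Real.continuous_fourierChar
      (by exact continuous_inner) hφc_int
  have hF_bd : ∀ ξ, ‖F ξ‖ ≤ A₁ := fun ξ => by
    rw [hF]
    refine (VectorFourier.norm_fourierIntegral_le_integral_norm _ _ _ _ _).trans (le_of_eq ?_)
    rw [hA₁]
    refine integral_congr_ae (Eventually.of_forall fun x => ?_)
    simp [hφc, Complex.norm_real]
  have hA₁0 : 0 ≤ A₁ := (norm_nonneg _).trans (hF_bd 0)
  have hF_L2 : MemLp F 2 volume := by rw [hF]; exact memLp_two_fourierIntegral hφc_int hφc_L2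
  have hF_sq_int : Integrable (fun ξ => ‖F ξ‖ ^ 2) :=
    (memLp_two_iff_integrable_sq_norm hF_L2.1).1 hF_L2
  have hPlancherel : ∫ ξ, ‖F ξ‖ ^ 2 = E := by
    rw [hF, integral_norm_sq_fourierIntegral_eq hφc_int hφc_L2, ← hφsq]
    refine integral_congr_ae (Eventually.of_forall fun x => ?_)
    simp [hφc, Complex.norm_real, sq_abs]
  -- ### the frequency split at `ρ = 1/r`
  obtain ⟨ρ, hρ⟩ : ∃ ρ : ℝ, ρ = r⁻¹ := ⟨_, rfl⟩
  have hρ0 : 0 < ρ := by rw [hρ]; exact inv_pos.2 hr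
  obtain ⟨T, hT⟩ : ∃ T : Set (EuclideanSpace ℝ (Fin 3)), T = {ξ : (EuclideanSpace ℝ (Fin 3)) | ‖ξ‖ ≤ ρ} := ⟨_, rfl⟩
  have hTm : MeasurableSet T := by
    rw [hT]; exact (isClosed_le continuous_norm continuous_const).measurableSet
  -- kernels: `lowK = 1_T ‖ξ‖⁻²`, `h = 1_{Tᶜ} ‖ξ‖⁻²` with `h² = 1_{Tᶜ} ‖ξ‖⁻⁴`
  obtain ⟨lowK, hlowK⟩ : ∃ lowK : (EuclideanSpace ℝ (Fin 3)) → ℝ, lowK = T.indicator fun ζ => (‖ζ‖ ^ 2)⁻¹ := ⟨_, rfl⟩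
  obtain ⟨hK, hhK⟩ : ∃ hK : (EuclideanSpace ℝ (Fin 3)) → ℝ, hK = Tᶜ.indicator fun ζ => (‖ζ‖ ^ 2)⁻¹ := ⟨_, rfl⟩
  obtain ⟨highK, hhighK⟩ : ∃ hi : (EuclideanSpace ℝ (Fin 3)) → ℝ, hi = Tᶜ.indicator fun η => (‖η‖ ^ 4)⁻¹ := ⟨_, rfl⟩
  have hlowK_int : Integrable lowK := by
    rw [hlowK, hT]; exact MorreySharp.integrable_ball_inv_norm_sq ρ
  have hhighK_int : Integrable highK := by
    rw [hhighK, hT]; exact MorreySharp.integrable_tail_inv_norm_four hρ0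
  have hlowK0 : ∀ ξ, 0 ≤ lowK ξ := fun ξ => by
    rw [hlowK]; exact indicator_nonneg (fun ζ _ => by positivity) ξ
  have hhK0 : ∀ ξ, 0 ≤ hK ξ := fun ξ => by
    rw [hhK]; exact indicator_nonneg (fun ζ _ => by positivity) ξ
  have hhK_sq : ∀ ξ, hK ξ ^ 2 = highK ξ := fun ξ => by
    rw [hhK, hhighK]
    by_cases hξ : ξ ∈ Tᶜ
    · rw [indicator_of_mem hξ, indicator_of_mem hξ]; ring
    · rw [indicator_of_notMem hξ, indicator_of_notMem hξ]; ring
  have hhK_meas : AEStronglyMeasurable hK volume := by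
    rw [hhK]
    exact ((continuous_norm.pow 2).measurable.inv.indicator hTm.compl).aestronglyMeasurable
  have hhK_L2 : MemLp hK 2 volume := by
    refine (memLp_two_iff_integrable_sq hhK_meas).2 ?_
    exact hhighK_int.congr (Eventually.of_forall fun ξ => (hhK_sq ξ).symm)
  -- the two pieces of the dual functional
  obtain ⟨jlow, hjlow⟩ : ∃ jlow : (EuclideanSpace ℝ (Fin 3)) → ℝ, jlow = fun ξ => ‖F ξ‖ * lowK ξ := ⟨_, rfl⟩
  obtain ⟨jhigh, hjhigh⟩ : ∃ jhigh : (EuclideanSpace ℝ (Fin 3)) → ℝ, jhigh = fun ξ => ‖F ξ‖ * hK ξ := ⟨_, rfl⟩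
  have hsplit : ∀ ξ, ‖F ξ‖ / ‖ξ‖ ^ 2 = jlow ξ + jhigh ξ := fun ξ => by
    simp only [hjlow, hjhigh, hlowK, hhK]
    by_cases hξ : ξ ∈ T
    · rw [indicator_of_mem hξ, indicator_of_notMem (fun h : ξ ∈ Tᶜ => h hξ), mul_zero,
        add_zero, div_eq_mul_inv]
    · rw [indicator_of_notMem hξ, indicator_of_mem hξ, mul_zero, zero_add, div_eq_mul_inv]
  have hFJ : ∀ ξ, ‖𝓕 (fun x => (φ x : ℂ)) ξ‖ / ‖ξ‖ ^ 2 = jlow ξ + jhigh ξ := fun ξ => by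
    rw [← hsplit ξ, hF, hφc]
  have hjlow0 : ∀ ξ, 0 ≤ jlow ξ := fun ξ => by
    rw [hjlow]; exact mul_nonneg (norm_nonneg _) (hlowK0 ξ)
  have hjhigh0 : ∀ ξ, 0 ≤ jhigh ξ := fun ξ => by
    rw [hjhigh]; exact mul_nonneg (norm_nonneg _) (hhK0 ξ)
  have hjlow_le : ∀ ξ, jlow ξ ≤ A₁ * lowK ξ := fun ξ => by
    rw [hjlow]; exact mul_le_mul_of_nonneg_right (hF_bd ξ) (hlowK0 ξ)
  have hjlow_int : Integrable jlow := by
    refine Integrable.mono' (hlowK_int.const_mul A₁) ?_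
      (Eventually.of_forall fun ξ => ?_)
    · rw [hjlow]; exact hF_cont.norm.aestronglyMeasurable.mul hlowK_int.aestronglyMeasurable
    · rw [Real.norm_of_nonneg (hjlow0 ξ)]
      exact hjlow_le ξ
  have hjhigh_int : Integrable jhigh := by
    refine Integrable.mono' ((hF_sq_int.add (hhK_L2.integrable_sq)).div_const 2) ?_
      (Eventually.of_forall fun ξ => ?_)
    · rw [hjhigh]; exact hF_cont.norm.aestronglyMeasurable.mul hhK_meas
    · rw [Real.norm_of_nonneg (hjhigh0 ξ), hjhigh]
      have := two_mul_le_add_sq ‖F ξ‖ (hK ξ)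
      simp only [Pi.add_apply]
      linarith
  have hJ_int : Integrable (fun ξ : (EuclideanSpace ℝ (Fin 3)) => ‖𝓕 (fun x => (φ x : ℂ)) ξ‖ / ‖ξ‖ ^ 2) :=
    (hjlow_int.add hjhigh_int).congr (Eventually.of_forall fun ξ => (hFJ ξ).symm)
  -- ### the two bounds
  have hlow_le : ∫ ξ, jlow ξ ≤ 3 * V * Real.sqrt V * s * e := by
    have h1 : ∫ ξ, jlow ξ ≤ ∫ ξ, A₁ * lowK ξ :=
      integral_mono hjlow_int (hlowK_int.const_mul A₁) hjlow_le
    rw [integral_const_mul] at h1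
    have h2 : ∫ ξ, lowK ξ ≤ 3 * V * ρ := by
      rw [hlowK, hT, hV]; exact MorreySharp.integral_ball_inv_norm_sq_le hρ0.le
    calc ∫ ξ, jlow ξ ≤ A₁ * (3 * V * ρ) := h1.trans (mul_le_mul_of_nonneg_left h2 hA₁0)
      _ ≤ Real.sqrt V * r * s * e * (3 * V * ρ) :=
          mul_le_mul_of_nonneg_right hA₁_le (by positivity)
      _ = 3 * V * Real.sqrt V * s * e := by
          rw [hρ]; field_simp
  have hhigh_le : ∫ ξ, jhigh ξ ≤ Real.sqrt (3 * V) * s * e := by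
    have hCS := integral_mul_le_sqrt_mul_sqrt (μ := volume) (f := fun ξ => ‖F ξ‖) (g := hK)
      (Eventually.of_forall fun _ => norm_nonneg _) (Eventually.of_forall hhK0) hF_L2.norm hhK_L2
    rw [hPlancherel] at hCS
    have h2 : ∫ ξ, hK ξ ^ 2 ≤ 3 * V * ρ⁻¹ := by
      rw [integral_congr_ae (Eventually.of_forall hhK_sq), hhighK, hT, hV]
      exact MorreySharp.integral_tail_inv_norm_four_le hρ0
    have hj : ∫ ξ, jhigh ξ = ∫ ξ, ‖F ξ‖ * hK ξ := by rw [hjhigh]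
    calc ∫ ξ, jhigh ξ = ∫ ξ, ‖F ξ‖ * hK ξ := hj
      _ ≤ Real.sqrt E * Real.sqrt (∫ ξ, hK ξ ^ 2) := hCS
      _ ≤ Real.sqrt E * Real.sqrt (3 * V * ρ⁻¹) :=
          mul_le_mul_of_nonneg_left (Real.sqrt_le_sqrt h2) (Real.sqrt_nonneg _)
      _ = Real.sqrt (3 * V) * s * e := by
          rw [hρ, inv_inv, Real.sqrt_mul (by positivity : (0:ℝ) ≤ 3 * V), ← hs, ← he]; ring
  -- ### `E ≤ C K s e`, hence `E ≤ C² K² r`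
  obtain ⟨K, hKdef⟩ : ∃ K : ℝ, K = 3 * V * Real.sqrt V + Real.sqrt (3 * V) := ⟨_, rfl⟩
  have hK0 : 0 ≤ K := by rw [hKdef]; positivity
  have hmain : E ≤ C * K * s * e := by
    have h := hPM φ hφ_int hJ_int
    rw [hpair, abs_of_nonneg hE0, integral_congr_ae (Eventually.of_forall hFJ),
      integral_add hjlow_int hjhigh_int] at h
    calc E ≤ C * ((∫ ξ, jlow ξ) + ∫ ξ, jhigh ξ) := h
      _ ≤ C * (3 * V * Real.sqrt V * s * e + Real.sqrt (3 * V) * s * e) :=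
          mul_le_mul_of_nonneg_left (add_le_add hlow_le hhigh_le) hC
      _ = C * K * s * e := by rw [hKdef]; ring
  have hKsq : K ^ 2 ≤ 18 * V ^ 3 + 6 * V := by
    have hVV : Real.sqrt V ^ 2 = V := Real.sq_sqrt hV0
    have h3V : Real.sqrt (3 * V) ^ 2 = 3 * V := Real.sq_sqrt (by positivity)
    have hab : K ^ 2 ≤ 2 * (3 * V * Real.sqrt V) ^ 2 + 2 * Real.sqrt (3 * V) ^ 2 := by
      rw [hKdef]; nlinarith [sq_nonneg (3 * V * Real.sqrt V - Real.sqrt (3 * V))]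
    calc K ^ 2 ≤ 2 * (3 * V * Real.sqrt V) ^ 2 + 2 * Real.sqrt (3 * V) ^ 2 := hab
      _ = 18 * V ^ 3 + 6 * V := by rw [mul_pow, hVV, h3V]; ring
  -- conclude
  have hfinal : E ≤ C ^ 2 * K ^ 2 * r := by
    rcases he0.eq_or_lt with he00 | hepos
    · -- `e = 0`, so `E = 0`
      have : E = 0 := by rw [← heE, ← he00]; ring
      rw [this]; positivity
    · have h1 : e ≤ C * K * s := by
        have : e * e ≤ C * K * s * e := by nlinarith [hmain, heE]
        exact le_of_mul_le_mul_right this hepos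
      have h0 : 0 ≤ C * K * s := by positivity
      calc E = e ^ 2 := heE.symm
        _ ≤ (C * K * s) ^ 2 := pow_le_pow_left₀ he0 h1 2
        _ = C ^ 2 * K ^ 2 * r := by rw [mul_pow, mul_pow, hsr]
  calc E ≤ C ^ 2 * K ^ 2 * r := hfinal
    _ ≤ C ^ 2 * (18 * V ^ 3 + 6 * V) * r := by
        have : 0 ≤ C ^ 2 * r := by positivity
        nlinarith [hKsq]
    _ = (18 * V ^ 3 + 6 * V) * C ^ 2 * r := by ring

end PMDual

/-! ### The vector statement and the version along the past of an ancient field -/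

/-- **The dual `PM²` bound implies the Morrey bound** (`PM² ⊂ Ṁ^{2,1}` in dual form; statement
and proof in the module docstring): if `w : ℝ³ → ℝ³` is a.e.-strongly measurable and bounded and
each component obeys `|∫ w_l φ| ≤ C ∫ ‖𝓕φ‖/‖ξ‖²` for all admissible real `φ`, then
`∫_{B_r(y)} ‖w‖² ≤ (54|B₁|³ + 18|B₁|) C² r` for every centre `y` and radius `r > 0`.
[cite: LemarieRieusset2016, §8.5] -/
theorem setIntegral_ball_norm_sq_le_of_pmDual {w : (EuclideanSpace ℝ (Fin 3)) → (EuclideanSpace ℝ (Fin 3))} {C B : ℝ} (hC : 0 ≤ C)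
    (hwm : AEStronglyMeasurable w volume) (hwb : ∀ x, ‖w x‖ ≤ B)
    (hPM : ∀ (l : Fin 3) (φ : (EuclideanSpace ℝ (Fin 3)) → ℝ), Integrable φ →
      Integrable (fun ξ : (EuclideanSpace ℝ (Fin 3)) => ‖𝓕 (fun x => (φ x : ℂ)) ξ‖ / ‖ξ‖ ^ 2) →
      |∫ x, w x l * φ x| ≤ C * ∫ ξ, ‖𝓕 (fun x => (φ x : ℂ)) ξ‖ / ‖ξ‖ ^ 2)
    (y : (EuclideanSpace ℝ (Fin 3))) {r : ℝ} (hr : 0 < r) :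
    ∫ x in ball y r, ‖w x‖ ^ 2 ≤
      (54 * (volume (ball (0 : EuclideanSpace ℝ (Fin 3)) 1)).toReal ^ 3 + 18 * (volume (ball (0 : EuclideanSpace ℝ (Fin 3)) 1)).toReal) *
        C ^ 2 * r := by
  have hml : ∀ l : Fin 3, AEStronglyMeasurable (fun x => w x l) volume := fun l =>
    (EuclideanSpace.proj l).continuous.comp_aestronglyMeasurable hwm
  have hbl : ∀ (l : Fin 3) (x : (EuclideanSpace ℝ (Fin 3))), |w x l| ≤ B := fun l x => by
    rw [← Real.norm_eq_abs]
    exact (PiLp.norm_apply_le (w x) l).trans (hwb x)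
  have hl : ∀ l : Fin 3, ∫ x in ball y r, w x l ^ 2 ≤
      (18 * (volume (ball (0 : EuclideanSpace ℝ (Fin 3)) 1)).toReal ^ 3 + 6 * (volume (ball (0 : EuclideanSpace ℝ (Fin 3)) 1)).toReal) *
        C ^ 2 * r := fun l =>
    PMDual.setIntegral_sq_le_of_pmDual hC (hml l) (hbl l) (hPM l) y hr
  have hnorm : ∀ x : (EuclideanSpace ℝ (Fin 3)), ‖w x‖ ^ 2 = ∑ l, w x l ^ 2 := fun x => by
    rw [EuclideanSpace.norm_sq_eq]
    refine Finset.sum_congr rfl fun l _ => ?_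
    rw [Real.norm_eq_abs, sq_abs]
  have hint : ∀ l : Fin 3, Integrable (fun x => w x l ^ 2) (volume.restrict (ball y r)) := by
    intro l
    refine Measure.integrableOn_of_bounded (M := B ^ 2) measure_ball_lt_top.ne
      ((hml l).pow 2) (Eventually.of_forall fun x => ?_)
    rw [Real.norm_eq_abs, abs_of_nonneg (sq_nonneg _), ← sq_abs]
    exact pow_le_pow_left₀ (abs_nonneg _) (hbl l x) 2
  calc ∫ x in ball y r, ‖w x‖ ^ 2 = ∫ x in ball y r, ∑ l, w x l ^ 2 :=
        integral_congr_ae (Eventually.of_forall hnorm)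
    _ = ∑ l, ∫ x in ball y r, w x l ^ 2 := integral_finsetSum _ fun l _ => hint l
    _ ≤ ∑ _l : Fin 3, (18 * (volume (ball (0 : EuclideanSpace ℝ (Fin 3)) 1)).toReal ^ 3 +
          6 * (volume (ball (0 : EuclideanSpace ℝ (Fin 3)) 1)).toReal) * C ^ 2 * r :=
        Finset.sum_le_sum fun l _ => hl l
    _ = _ := by
        rw [Finset.sum_const, Finset.card_univ, Fintype.card_fin, nsmul_eq_mul]
        push_cast
        ring

/-- **Along the past of a bounded field with continuous slices, the dual `PM²` bound at all
negative times gives the all-radii Morrey bound at all negative times** — hypothesis four of the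
open stub `stub_liouvillePM` (L_PM) of the line follows from hypothesis five (reshape r5). The
constant may be taken `M' = (54|B₁|³ + 18|B₁|) (max C' 0)²`. [cite: LemarieRieusset2016, §8.5] -/
theorem morrey_of_pmDual_past {v : ℝ → (EuclideanSpace ℝ (Fin 3)) → (EuclideanSpace ℝ (Fin 3))}
    (hbd : Literature.Analysis.FluidPDE.IsBoundedOn (Set.Iio 0) v)
    (hcont : ∀ t < 0, Continuous (v t))
    (hPM : ∃ C' : ℝ, ∀ t < 0, ∀ (l : Fin 3) (φ : (EuclideanSpace ℝ (Fin 3)) → ℝ), Integrable φ →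
      Integrable (fun ξ : (EuclideanSpace ℝ (Fin 3)) => ‖𝓕 (fun x => (φ x : ℂ)) ξ‖ / ‖ξ‖ ^ 2) →
      |∫ y, v t y l * φ y| ≤ C' * ∫ ξ : (EuclideanSpace ℝ (Fin 3)), ‖𝓕 (fun x => (φ x : ℂ)) ξ‖ / ‖ξ‖ ^ 2) :
    ∃ M' : ℝ, ∀ t < 0, ∀ (y : (EuclideanSpace ℝ (Fin 3))) (r : ℝ), 0 < r →
      ∫ x in ball y r, ‖v t x‖ ^ 2 ≤ M' * r := by
  obtain ⟨C', hC'⟩ := hPM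
  obtain ⟨B, hB⟩ := hbd
  refine ⟨(54 * (volume (ball (0 : EuclideanSpace ℝ (Fin 3)) 1)).toReal ^ 3 + 18 * (volume (ball (0 : EuclideanSpace ℝ (Fin 3)) 1)).toReal) *
    (max C' 0) ^ 2, fun t ht y r hr => ?_⟩
  have hPMt : ∀ (l : Fin 3) (φ : (EuclideanSpace ℝ (Fin 3)) → ℝ), Integrable φ →
      Integrable (fun ξ : (EuclideanSpace ℝ (Fin 3)) => ‖𝓕 (fun x => (φ x : ℂ)) ξ‖ / ‖ξ‖ ^ 2) →
      |∫ x, v t x l * φ x| ≤ max C' 0 * ∫ ξ, ‖𝓕 (fun x => (φ x : ℂ)) ξ‖ / ‖ξ‖ ^ 2 := by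
    intro l φ hφ hJ
    have hJ0 : 0 ≤ ∫ ξ, ‖𝓕 (fun x => (φ x : ℂ)) ξ‖ / ‖ξ‖ ^ 2 :=
      integral_nonneg fun ξ => div_nonneg (norm_nonneg _) (sq_nonneg _)
    exact (hC' t ht l φ hφ hJ).trans (mul_le_mul_of_nonneg_right (le_max_left _ _) hJ0)
  exact setIntegral_ball_norm_sq_le_of_pmDual (le_max_right _ _) (hcont t ht).aestronglyMeasurable
    (fun x => hB t ht x) hPMt y hr

/-- **Registered sub-goal `stub_morreyOfPMDual` (lead c5, reshape r5)**, in the vocabulary of the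
open stub `stub_liouvillePM`: for a bounded ancient mild solution, jointly smooth on the open past,
the dual `PM²` bound at all negative times (hypothesis five of (L_PM)) implies the all-radii
Morrey bound at all negative times (hypothesis four of (L_PM)). [cite: LemarieRieusset2016, §8.5] -/
theorem stub_morreyOfPMDual :
    ∀ v : ℝ → EuclideanSpace ℝ (Fin 3) → EuclideanSpace ℝ (Fin 3),
      Literature.Analysis.FluidPDE.IsBoundedAncientMildSolution 1 v →
      ContDiffOn ℝ (⊤ : ℕ∞) (Function.uncurry v) (Set.Iio 0 ×ˢ Set.univ) →
      (∃ C' : ℝ, ∀ t < 0, ∀ (l : Fin 3) (φ : EuclideanSpace ℝ (Fin 3) → ℝ),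
        MeasureTheory.Integrable φ →
        MeasureTheory.Integrable (fun ξ : EuclideanSpace ℝ (Fin 3) =>
          ‖FourierTransform.fourier (fun x => (φ x : ℂ)) ξ‖ / ‖ξ‖ ^ 2) →
        |∫ y, v t y l * φ y| ≤
          C' * ∫ ξ : EuclideanSpace ℝ (Fin 3), ‖FourierTransform.fourier (fun x => (φ x : ℂ)) ξ‖ / ‖ξ‖ ^ 2) →
      ∃ M' : ℝ, ∀ t < 0, ∀ (y : EuclideanSpace ℝ (Fin 3)) (r : ℝ), 0 < r →
        ∫ x in Metric.ball y r, ‖v t x‖ ^ 2 ≤ M' * r := by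
  intro v hv hsm hPM
  have hcont : ∀ t < 0, Continuous (v t) := fun t ht =>
    hsm.continuousOn.comp_continuous (continuous_const.prodMk continuous_id)
      fun x => ⟨ht, Set.mem_univ x⟩
  exact morrey_of_pmDual_past hv.isBoundedOn hcont hPM

end Summit.NavierStokesRegularity.NavierStokesRegularity.Theorems.BoundedEnvelope

end
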